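import Summits.BirchSwinnertonDyer.BirchSwinnertonDyer.Theorems.ManinLocalTwoThreeAtkinLehnerSignFour
import Summits.BirchSwinnertonDyer.BirchSwinnertonDyer.Theorems.ManinLocalTwoThreeTranslationStableTwistInvariance
import Summits.BirchSwinnertonDyer.Rank1Residual.O5.CharTwistThreeIsometry
import HarnessLib

/-!
# `w₉ = +1` on same-level `χ₋₃`-twist pairs at `9 ∥ N`: the `A₄`-relation `(w(9)·t_{1/3})³ = 729·γ₀` and the plane
# `⟨f, f ⊗ χ₋₃⟩`

Summit `BirchSwinnertonDyer`, sub-problem `BirchSwinnertonDyer`, route `ManinLocalTwoThree`; width seat `bsd-line-manin23-p2`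
(gen 8), `--supports` crux C3 `ManinPrimeToThreeAtNine` (stmt-BirchSwinnertonDyer-22968).  Cell `bsd-f2-manin`: the `p = 3`
counterpart of the seat's E-an-44 (`λ₄ = −1` at `4 ∥ N` from `(w(4)t)³ = 64γ`).  At `9 ∥ N` the normaliser quotient
`N(Γ₀(9))/ℚ^×Γ₀(9)` is `A₄ ≅ PSL₂(𝔽₃)`, generated by the translation `t_{1/3}` (order `3`) and `w₉` (an involution, hence in the
commutator subgroup `V₄`); so `w₉` acts TRIVIALLY on every `⟨w₉, t_{1/3}⟩`-stable plane on which `A₄` acts through a sum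
of characters — in particular on `⟨f, f ⊗ χ₋₃⟩` whenever `f ⊗ χ₋₃` is again a `w₉`-eigenform of level `9M` (the
supercuspidal-at-`3` newforms; Kodaira III / III* for elliptic curves: the `{v₃Δ ∈ {3, 9}} ↦ +1` half of the cell's `9 ∥ N`
sign law, here `E`-free).  Relevant to the desc lens (Conway–Norton planes, E-desc-52/54: `w₉ = id` on every same-level
twist plane at `9 ∥ N`) and to C3 bookkeeping.

PROVED here (sorry-free, axioms standard):
* **`atkinLehnerW_nine_mul_thirdTranslateGL_cube`** — `(w(9)·t_{1/3})³ = 729·γ₀`, `γ₀ ∈ Γ₀(9M)` explicit (`3 ∤ M`);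
* `zeta3_pow_add_zeta3_sq_pow`, `zeta3_pow_eq_of_not_dvd`, **`thirdTranslate_one_eq_of_depleted`** —
  `t_{1/3} f = −½ f + ((ζ₃ − ζ₃²)/2)(f ⊗ χ₋₃)` for `3`-depleted `f`;
* **`atkinLehnerInvolution_nine_eq_self_of_charTwist_isNewform0`** — `3 ∤ M`, `f` and `f ⊗ χ₋₃` newforms on `Γ₀(9M)` ⟹
  `w₉ f = f`; `atkinLehnerInvolution_nine_charTwist_eq_self` — and `w₉(f ⊗ χ₋₃) = f ⊗ χ₋₃`.

Proof of the main theorem: on the plane, `t_{1/3} = (−½, c/2; c/2, −½)` (`c² = −3`), `w₉ = diag(ε, ε')`; `f ∣ (w(9)t)³ = f`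
reads `((ε+3ε')/4) f + (c(ε−ε')/4) f' = f`; `a₁(f) = a₁(f') = 1` gives `1 = (ε+3ε')/4 + c(ε−ε')/4`, which excludes
`(ε,ε') = (1,−1)` (`c = 3`), `(−1,1)` (`c = −1`) and `(−1,−1)` (`1 = −1`).  BSD is not proved by this; Manin's conjecture is
not proved by this. [cite: AtkinLehner1970, §4 and Lemma 27] [cite: Knapp1993, Thm. 9.27]
-/

set_option autoImplicit false
-- `Summit.BirchSwinnertonDyer.BirchSwinnertonDyer` is the mandated summit-side namespace (single-conjunct summit).
set_option linter.dupNamespace false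

noncomputable section

open scoped MatrixGroups ModularForm
open CongruenceSubgroup Matrix.SpecialLinearGroup UpperHalfPlane
open Literature.NumberTheory.EllipticCurves Literature.NumberTheory.EllipticCurves.ModularForms
open Summit.BirchSwinnertonDyer.Rank1Residual.ManinAdditive
open Summit.BirchSwinnertonDyer.Rank1Residual.ManinAdditive.RamanujanCut
open Summit.BirchSwinnertonDyer.Rank1Residual.ManinAdditive.ConwayNortonThree
open Summit.BirchSwinnertonDyer.Rank1Residual.O5

namespace Summit.BirchSwinnertonDyer.BirchSwinnertonDyer.Theorems.ManinLocalTwoThree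

/-! ### `(w(9)·t_{1/3})³ = 729·γ₀` with `γ₀ ∈ Γ₀(9M)` (`3 ∤ M`): the `A₄`-relation of the normaliser of `Γ₀(9)` -/

/-- **The cube of `w(9)·t_{1/3}` is `729` times an element of `Γ₀(9M)`** (`3 ∤ M`; `w(9) = (9x, y; 9M, 9)` with
`9x − My = 1`, `t_{1/3} = (3 1; 0 3)`).  With `s = 3x + y` and `3K = (3x+M+2)(3x+M+4)` (an integer since `3 ∤ M`) the
matrix is `γ₀ = (27x³ + 6Msx + M²s + 3Ms, sK; 9MK, s(3Mx + 2M² + 6M) + (M+3)³)`.  (The image of `⟨w(9), t_{1/3}⟩` in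
`N(Γ₀(9M))/ℚ^×Γ₀(9M)` is `A₄ ≅ PSL₂(𝔽₃)`; this is its relation `(s·t)³ = 1`.) [cite: AtkinLehner1970, Lemma 27 and §4] -/
theorem atkinLehnerW_nine_mul_thirdTranslateGL_cube {M : ℕ} [NeZero (9 * M)] (hM : ¬ 3 ∣ M)
    (hcop : Nat.Coprime 9 (9 * M / 9)) :
    ∃ γ : SL(2, ℤ), γ ∈ Gamma0 (9 * M) ∧
      glCast (atkinLehnerW (9 * M) 9 : GL (Fin 2) ℚ) * glCast (thirdTranslateGL 1 : GL (Fin 2) ℚ) *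
          (glCast (atkinLehnerW (9 * M) 9 : GL (Fin 2) ℚ) * glCast (thirdTranslateGL 1 : GL (Fin 2) ℚ)) *
          (glCast (atkinLehnerW (9 * M) 9 : GL (Fin 2) ℚ) * glCast (thirdTranslateGL 1 : GL (Fin 2) ℚ)) =
        tpD 729 * tpG 729 * mapGL ℝ γ := by
  have h9 : 9 ∣ 9 * M := dvd_mul_right 9 M
  have hdiv : 9 * M / 9 = M := Nat.mul_div_cancel_left M (by norm_num)
  set x : ℤ := atkinLehnerSL (9 * M) 9 0 0 with hx
  set y : ℤ := atkinLehnerSL (9 * M) 9 0 1 with hy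
  have hbez : 9 * x - (M : ℤ) * y = 1 := by
    have h := atkinLehnerSL_bezout (9 * M) 9 hcop
    rw [hdiv] at h
    exact_mod_cast h
  -- `3K = (3x + M + 2)(3x + M + 4)` has an integer solution since `3 ∤ M`
  obtain ⟨K, hK⟩ : ∃ K : ℤ, 3 * K = (3 * x + M + 2) * (3 * x + M + 4) := by
    have h3 : M % 3 = 1 ∨ M % 3 = 2 := by omega
    rcases h3 with h1 | h2
    · obtain ⟨m, hm⟩ : ∃ m, M = 3 * m + 1 := ⟨M / 3, by omega⟩
      exact ⟨(x + m + 1) * (3 * x + M + 4), by rw [hm]; push_cast; ring⟩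
    · obtain ⟨m, hm⟩ : ∃ m, M = 3 * m + 2 := ⟨M / 3, by omega⟩
      exact ⟨(3 * x + M + 2) * (x + m + 2), by rw [hm]; push_cast; ring⟩
  let A : Matrix (Fin 2) (Fin 2) ℤ :=
    !![27 * x ^ 3 + 6 * M * (3 * x + y) * x + M ^ 2 * (3 * x + y) + 3 * M * (3 * x + y), (3 * x + y) * K;
      9 * M * K, (3 * x + y) * (3 * M * x + 2 * M ^ 2 + 6 * M) + (M + 3) ^ 3]
  have hdet : A.det = 1 := by
    rw [Matrix.det_fin_two_of]
    linear_combination ((9 * x - (M : ℤ) * y) ^ 2 + (9 * x - (M : ℤ) * y) + 1 -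
        (M : ℤ) * (3 * x + y) * ((9 * x ^ 2 + 6 * M * x + M * y + 9 * x + M ^ 2 + 6 * M + 9) +
          (3 * x + M + 2) * (3 * x + M + 4))) * hbez
      + (-((M : ℤ) * (3 * x + y) * ((3 * x + M + 2) * (3 * x + M + 4) + 3 * K))) * hK
  let γ : SL(2, ℤ) := ⟨A, hdet⟩
  have hγ : γ ∈ Gamma0 (9 * M) := by
    rw [Gamma0_mem]
    show ((9 * M * K : ℤ) : ZMod (9 * M)) = 0
    rw [ZMod.intCast_zmod_eq_zero_iff_dvd]
    exact ⟨K, by push_cast; ring⟩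
  refine ⟨γ, hγ, ?_⟩
  have hbezR : 9 * (x : ℝ) - (M : ℝ) * (y : ℝ) = 1 := by exact_mod_cast hbez
  have hKR : 3 * (K : ℝ) = (3 * (x : ℝ) + M + 2) * (3 * x + M + 4) := by exact_mod_cast hK
  have hNR : ((9 * M : ℕ) : ℝ) = 9 * (M : ℝ) := by push_cast; ring
  apply Matrix.GeneralLinearGroup.ext
  intro i j
  simp only [Matrix.GeneralLinearGroup.coe_mul, val_glCast_atkinLehnerW (9 * M) 9 h9 hcop, val_glCast_thirdTranslateGL,
    val_tpD, val_tpG, val_mapGL', ← hx, ← hy]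
  rw [hNR]
  fin_cases i <;> fin_cases j <;>
    simp only [γ, A, Matrix.mul_apply, Fin.sum_univ_two, Matrix.map_apply,
      Matrix.of_apply, Matrix.cons_val', Matrix.cons_val_zero, Matrix.cons_val_one, Matrix.empty_val',
      Matrix.cons_val_fin_one, Fin.isValue, Fin.zero_eta, Fin.mk_one] <;> push_cast
  · ring
  · linear_combination (-243 * ((3 : ℝ) * x + y)) * hbezR + (-243 * ((3 : ℝ) * x + y)) * hKR
  · linear_combination (-2187 * (M : ℝ)) * hbezR + (-2187 * (M : ℝ)) * hKR
  · ring

/-! ### `t_{1/3}` on the plane `⟨f, f ⊗ χ₋₃⟩`: `t f = −½ f + ((ζ₃ − ζ₃²)/2)·(f ⊗ χ₋₃)` for `3`-depleted `f` -/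

/-- `ζ₃ⁿ + ζ₃²ⁿ = −1` for `3 ∤ n`. -/
theorem zeta3_pow_add_zeta3_sq_pow {n : ℕ} (hn : ¬ 3 ∣ n) : zeta3 ^ n + (zeta3 ^ 2) ^ n = -1 := by
  have h3 : zeta3 ^ 3 = 1 := isPrimitiveRoot_zeta3.pow_eq_one
  have hζ1 : zeta3 ≠ 1 := isPrimitiveRoot_zeta3.ne_one (by norm_num)
  have h111 : zeta3 ^ 2 + zeta3 + 1 = 0 := by
    have : (zeta3 - 1) * (zeta3 ^ 2 + zeta3 + 1) = 0 := by linear_combination h3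
    exact (mul_eq_zero.mp this).resolve_left (sub_ne_zero.mpr hζ1)
  have key : ∀ m : ℕ, zeta3 ^ m = zeta3 ^ (m % 3) := fun m => by
    conv_lhs => rw [← Nat.div_add_mod m 3, pow_add, pow_mul, h3, one_pow, one_mul]
  rw [← pow_mul, key n, key (2 * n)]
  have hcase : n % 3 = 1 ∨ n % 3 = 2 := by omega
  rcases hcase with h | h
  · rw [h, show 2 * n % 3 = 2 by omega]
    linear_combination h111
  · rw [h, show 2 * n % 3 = 1 by omega]
    linear_combination h111

/-- `ζ₃ⁿ = −½ + ((ζ₃ − ζ₃²)/2)·χ(n)` for `3 ∤ n` and the primitive quadratic character `χ` mod `3`. -/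
theorem zeta3_pow_eq_of_not_dvd {χ : DirichletCharacter ℂ 3} (hχ : χ.IsQuadratic) (hprim : χ.IsPrimitive) {n : ℕ}
    (hn : ¬ 3 ∣ n) : zeta3 ^ n = -(1 / 2 : ℂ) + (zeta3 - zeta3 ^ 2) / 2 * χ (n : ZMod 3) := by
  have hsum := zeta3_pow_add_zeta3_sq_pow hn
  have hdiff := zeta3_pow_sub_div_eq_chi hχ hprim n
  have hc : zeta3 - zeta3 ^ 2 ≠ 0 := by
    intro h
    have h' := conj_zeta3_sub_sq
    have h3 : zeta3 ^ 3 = 1 := isPrimitiveRoot_zeta3.pow_eq_one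
    have hζ1 : zeta3 ≠ 1 := isPrimitiveRoot_zeta3.ne_one (by norm_num)
    have hζ0 : zeta3 ≠ 0 := fun h0 => by rw [h0] at h3; norm_num at h3
    have : zeta3 * (1 - zeta3) = 0 := by linear_combination h
    rcases mul_eq_zero.mp this with h0 | h0
    · exact hζ0 h0
    · exact hζ1 (by linear_combination -h0)
  have hdiff' : (zeta3 ^ 1) ^ n - (zeta3 ^ 2) ^ n = (zeta3 - zeta3 ^ 2) * χ (n : ZMod 3) := by
    rw [← hdiff, ← mul_assoc, mul_inv_cancel₀ hc, one_mul]
  rw [pow_one] at hdiff'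
  linear_combination (1 / 2 : ℂ) * hsum + (1 / 2 : ℂ) * hdiff'

/-- **`t_{1/3} f = −½·f + ((ζ₃ − ζ₃²)/2)·(f ⊗ χ₋₃)`** for a `3`-depleted `f ∈ S₂(Γ₀(N))`, `9 ∣ N`: the translation by `⅓`
preserves the plane spanned by `f` and its `χ₋₃`-twist. -/
theorem thirdTranslate_one_eq_of_depleted {N : ℕ} [NeZero N] (h9 : 3 ^ 2 ∣ N) {χ : DirichletCharacter ℂ 3}
    (hχ : χ.IsQuadratic) (hprim : χ.IsPrimitive) (f : CuspForm (Gamma0 N) 2) (hdep : ∀ n : ℕ, 3 ∣ n → cuspCoeff f n = 0) :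
    thirdTranslate N 2 1 f = (-(1 / 2 : ℂ)) • f + ((zeta3 - zeta3 ^ 2) / 2) • charTwist N dvd_rfl h9 hχ f := by
  have h9' : 9 ∣ N := by simpa using h9
  refine eq_of_forall_cuspCoeff_eq_gamma0 fun n => ?_
  rw [cuspCoeff_thirdTranslate_two h9' 1 f n, cuspCoeff_add_form (one_mem_strictPeriods_coe_gamma0 N), cuspCoeff_smul,
    cuspCoeff_smul, cuspCoeff_charTwist N dvd_rfl h9 hχ hprim f n, pow_one]
  by_cases hn : 3 ∣ n
  · rw [hdep n hn, mul_zero, mul_zero, mul_zero, mul_zero, add_zero]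
  · rw [zeta3_pow_eq_of_not_dvd hχ hprim hn]
    ring

/-! ### The main theorem: `w₉ = +1` on same-level `χ₋₃`-twist pairs at `9 ∥ N` -/

/-- **`w₉ f = f` for every newform `f` on `Γ₀(9M)` (`3 ∤ M`) whose `χ₋₃`-twist is again a newform of level `9M`.**
On the plane `V = ⟨f, f'⟩`, `f' = f ⊗ χ₋₃`, the translation `t_{1/3}` acts by `(−½, c/2; c/2, −½)` (`c = ζ₃ − ζ₃²`,
`c² = −3`) and `w₉` by `diag(ε, ε')`; the normaliser relation `(w(9)t)³ = 729·γ₀`, `γ₀ ∈ Γ₀(9M)`, forces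
`f ∣ (w(9)t)³ = f`, i.e. `((ε+3ε')/4)·f + (c(ε−ε')/4)·f' = f`, which with `a₁(f) = a₁(f') = 1` and `c² = −3` leaves only
`ε = ε' = +1`.  (The image of `⟨w₉, t_{1/3}⟩` is `A₄`, whose involutions lie in the commutator subgroup; a `2`-dimensional
representation of `A₄` is a sum of characters.)  In Kodaira terms this is the supercuspidal-at-`3` half of the cell's
`9 ∥ N` sign law (types III, III*: `w₃(E) = +1`).  BSD is not proved by this; Manin's conjecture is not proved by this.
[cite: AtkinLehner1970, Lemma 27 and Thm. 3] [cite: Knapp1993, Thm. 9.27] -/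
theorem atkinLehnerInvolution_nine_eq_self_of_charTwist_isNewform0 {M : ℕ} [NeZero (9 * M)] (hM : ¬ 3 ∣ M)
    {χ : DirichletCharacter ℂ 3} (hχ : χ.IsQuadratic) (hprim : χ.IsPrimitive) (h9 : 3 ^ 2 ∣ 9 * M)
    {f : CuspForm (Gamma0 (9 * M)) 2} (hf : IsNewform0 f) (hf' : IsNewform0 (charTwist (9 * M) dvd_rfl h9 hχ f)) :
    atkinLehnerInvolution (9 * M) 2 9 f = f := by
  have h9' : 9 ∣ 9 * M := dvd_mul_right 9 M
  have hdiv : 9 * M / 9 = M := Nat.mul_div_cancel_left M (by norm_num)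
  have hcop : Nat.Coprime 9 (9 * M / 9) := by
    rw [hdiv]
    have h3 : Nat.Coprime 3 M := (Nat.Prime.coprime_iff_not_dvd Nat.prime_three).mpr hM
    simpa using h3.pow_left 2
  set f' := charTwist (9 * M) dvd_rfl h9 hχ f with hf'def
  -- depletion and the twist involution
  have hdep : ∀ n : ℕ, 3 ∣ n → cuspCoeff f n = 0 := fun n hn => cuspCoeff_eq_zero_of_three_dvd_of_isNewform0 hf h9' hn
  have hdep' : ∀ n : ℕ, 3 ∣ n → cuspCoeff f' n = 0 := fun n hn => cuspCoeff_charTwist_eq_zero_of_dvd h9 hχ hprim f hn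
  have hff : charTwist (9 * M) dvd_rfl h9 hχ f' = f := charTwist_charTwist h9 hχ hprim hdep
  -- Atkin–Lehner signs
  obtain ⟨ε, hε1, hε⟩ := hf.exists_atkinLehnerInvolution_eq_smul h9' hcop
  obtain ⟨ε', hε1', hε'⟩ := hf'.exists_atkinLehnerInvolution_eq_smul h9' hcop
  obtain ⟨γ₀, hγ₀, hcube⟩ := atkinLehnerW_nine_mul_thirdTranslateGL_cube hM hcop
  set W : GL (Fin 2) ℝ := glCast (atkinLehnerW (9 * M) 9 : GL (Fin 2) ℚ) with hW
  set T : GL (Fin 2) ℝ := glCast (thirdTranslateGL 1 : GL (Fin 2) ℚ) with hT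
  set c : ℂ := zeta3 - zeta3 ^ 2 with hc
  have hc2 : c ^ 2 = -3 := by
    have h3 : zeta3 ^ 3 = 1 := isPrimitiveRoot_zeta3.pow_eq_one
    have hζ1 : zeta3 ≠ 1 := isPrimitiveRoot_zeta3.ne_one (by norm_num)
    have h111 : zeta3 ^ 2 + zeta3 + 1 = 0 := by
      have : (zeta3 - 1) * (zeta3 ^ 2 + zeta3 + 1) = 0 := by linear_combination h3
      exact (mul_eq_zero.mp this).resolve_left (sub_ne_zero.mpr hζ1)
    rw [hc]
    linear_combination h111 + (zeta3 - 2) * h3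
  -- slash formulas on the plane
  have hslW : (⇑f ∣[(2 : ℤ)] W) = ε • (⇑f : ℍ → ℂ) := by
    ext z; rw [hW, slash_atkinLehnerW_apply h9' hcop hε z, Pi.smul_apply, smul_eq_mul]
  have hslW' : (⇑f' ∣[(2 : ℤ)] W) = ε' • (⇑f' : ℍ → ℂ) := by
    ext z; rw [hW, slash_atkinLehnerW_apply h9' hcop hε' z, Pi.smul_apply, smul_eq_mul]
  have hone : (((9 : ℝ) ^ (1 - ((2 : ℤ) : ℝ) / 2) : ℝ) : ℂ) = 1 := by norm_num
  have hslT : (⇑f ∣[(2 : ℤ)] T) = (-(1 / 2 : ℂ)) • (⇑f : ℍ → ℂ) + (c / 2) • (⇑f' : ℍ → ℂ) := by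
    have h := coe_thirdTranslate_eq_slash h9' 1 f
    rw [hone, one_smul, thirdTranslate_one_eq_of_depleted h9 hχ hprim f hdep] at h
    rw [hT, ← h]
    rfl
  have hslT' : (⇑f' ∣[(2 : ℤ)] T) = (-(1 / 2 : ℂ)) • (⇑f' : ℍ → ℂ) + (c / 2) • (⇑f : ℍ → ℂ) := by
    have h := coe_thirdTranslate_eq_slash h9' 1 f'
    rw [hone, one_smul, thirdTranslate_one_eq_of_depleted h9 hχ hprim f' hdep', hff] at h
    rw [hT, ← h]
    rfl
  have hdetW : 0 < W.det.val := by rw [hW, det_glCast_atkinLehnerW]; norm_num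
  have hdetT : 0 < T.det.val := det_glCast_pos _
  set A : GL (Fin 2) ℝ := W * T with hA
  have hdetA : 0 < A.det.val := by rw [hA, map_mul, Units.val_mul]; exact mul_pos hdetW hdetT
  clear_value A
  -- one step of `A` on the plane
  have step : ∀ u v : ℂ, ((u • (⇑f : ℍ → ℂ) + v • (⇑f' : ℍ → ℂ)) ∣[(2 : ℤ)] A) =
      (-(u * ε) / 2 + v * ε' * c / 2) • (⇑f : ℍ → ℂ) + (u * ε * c / 2 - v * ε' / 2) • (⇑f' : ℍ → ℂ) := by
    intro u v
    rw [SlashAction.add_slash, ModularForm.smul_slash, ModularForm.smul_slash, σ_eq_self hdetA, σ_eq_self hdetA, hA,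
      SlashAction.slash_mul, SlashAction.slash_mul, hslW, hslW', ModularForm.smul_slash, ModularForm.smul_slash,
      σ_eq_self hdetT, σ_eq_self hdetT, hslT, hslT']
    ext z
    simp only [Pi.add_apply, Pi.smul_apply, smul_eq_mul]
    ring
  have hF : (⇑f : ℍ → ℂ) = (1 : ℂ) • (⇑f : ℍ → ℂ) + (0 : ℂ) • (⇑f' : ℍ → ℂ) := by simp
  have h3step : (⇑f ∣[(2 : ℤ)] (A * A * A)) =
      ((ε + 3 * ε') / 4) • (⇑f : ℍ → ℂ) + (c * (ε - ε') / 4) • (⇑f' : ℍ → ℂ) := by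
    have hε2 : ε ^ 2 = 1 := by rcases hε1 with rfl | rfl <;> norm_num
    have hε2' : ε' ^ 2 = 1 := by rcases hε1' with rfl | rfl <;> norm_num
    rw [SlashAction.slash_mul, SlashAction.slash_mul]
    conv_lhs => rw [hF]
    rw [step, step, step]
    congr 1 <;> congr 1
    · linear_combination (-ε / 8 - ε' * c ^ 2 / 4) * hε2 + (-(c ^ 2 * ε) / 8) * hε2' + (-ε' / 4 - ε / 8) * hc2
    · linear_combination (c * (ε + ε' * c ^ 2 + ε') / 8) * hε2 + (c * ε / 8) * hε2' + (c * ε' / 8) * hc2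
  have hfix : (⇑f ∣[(2 : ℤ)] (A * A * A)) = (⇑f : ℍ → ℂ) := by
    rw [hcube, SlashAction.slash_mul, slash_tpD_mul_tpG 729 2 ⇑f, sub_self, zpow_zero, one_smul]
    exact SlashInvariantFormClass.slash_action_eq f _ (Subgroup.mem_map_of_mem (mapGL ℝ) hγ₀)
  rw [hfix] at h3step
  -- read off the coefficients through `a₁(f) = a₁(f') = 1`
  have hf1 : cuspCoeff f 1 = 1 := hf.2.2
  have hf1' : cuspCoeff f' 1 = 1 := hf'.2.2
  have key : ∀ u v : ℂ, (⇑f : ℍ → ℂ) = u • (⇑f : ℍ → ℂ) + v • (⇑f' : ℍ → ℂ) → 1 = u + v := by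
    intro u v h
    have hforms : f = u • f + v • f' := DFunLike.coe_injective (by rw [h]; rfl)
    have hc1 : cuspCoeff f 1 = cuspCoeff (u • f + v • f') 1 := by rw [← hforms]
    rw [cuspCoeff_add_form (one_mem_strictPeriods_coe_gamma0 (9 * M)), cuspCoeff_smul, cuspCoeff_smul, hf1, hf1',
      mul_one, mul_one] at hc1
    exact hc1
  rcases hε1 with rfl | rfl <;> rcases hε1' with rfl | rfl
  · -- ε = ε' = 1
    rwa [one_smul] at hε
  · -- ε = 1, ε' = −1 : `1 = −½ + c/2`, so `c = 3`, contradicting `c² = −3`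
    exfalso
    have h1 := key _ _ h3step
    have hc3 : c = 3 := by linear_combination (-2) * h1
    rw [hc3] at hc2
    norm_num at hc2
  · -- ε = −1, ε' = 1 : `1 = ½ − c/2`, so `c = −1`, contradicting `c² = −3`
    exfalso
    have h1 := key _ _ h3step
    have hc1 : c = -1 := by linear_combination 2 * h1
    rw [hc1] at hc2
    norm_num at hc2
  · -- ε = ε' = −1 : `f = −f`
    exfalso
    have h1 := key _ _ h3step
    norm_num at h1

/-- **… and `w₉ (f ⊗ χ₋₃) = f ⊗ χ₋₃` as well** (the hypothesis is symmetric: `(f ⊗ χ) ⊗ χ = f`). -/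
theorem atkinLehnerInvolution_nine_charTwist_eq_self {M : ℕ} [NeZero (9 * M)] (hM : ¬ 3 ∣ M)
    {χ : DirichletCharacter ℂ 3} (hχ : χ.IsQuadratic) (hprim : χ.IsPrimitive) (h9 : 3 ^ 2 ∣ 9 * M)
    {f : CuspForm (Gamma0 (9 * M)) 2} (hf : IsNewform0 f) (hf' : IsNewform0 (charTwist (9 * M) dvd_rfl h9 hχ f)) :
    atkinLehnerInvolution (9 * M) 2 9 (charTwist (9 * M) dvd_rfl h9 hχ f) = charTwist (9 * M) dvd_rfl h9 hχ f := by
  have h9' : 9 ∣ 9 * M := dvd_mul_right 9 M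
  have hff : charTwist (9 * M) dvd_rfl h9 hχ (charTwist (9 * M) dvd_rfl h9 hχ f) = f :=
    charTwist_charTwist h9 hχ hprim fun n hn => cuspCoeff_eq_zero_of_three_dvd_of_isNewform0 hf h9' hn
  exact atkinLehnerInvolution_nine_eq_self_of_charTwist_isNewform0 hM hχ hprim h9 hf' (by rw [hff]; exact hf)

end Summit.BirchSwinnertonDyer.BirchSwinnertonDyer.Theorems.ManinLocalTwoThree

end
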